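import Summits.BirchSwinnertonDyer.BirchSwinnertonDyer.Theorems.QuadraticBranchSignedControlPlusEtaNonsurjPlusCoeffCongruenceMuCertificate
import HarnessLib

/-!
# Route `QuadraticBranchSignedControl` (rung K8, cell `bsd-potss`), residual crux `PlusEtaMainConjectureNonsurj`
# (stmt-BirchSwinnertonDyer-19606): THE QUOTIENT READING — `L_p⁺(V, η, X) ≡ v·ϖ·θ_{2m}(η)/ω⁻_{2m} (mod p^m)` COEFFICIENTWISE in
# degrees `≤ p(p−1)`, so EVERY `λ⁺ ≤ p(p−1)` (and `μ⁺ = 0`) is read EXACTLY, PER COEFFICIENT, off ONE even-level Mazur–Tate element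
# (seat `bsd-potss-k8eta-c2` g26; sequel of g25's `…PlusCoeffCongruence{Lambda,MuCertificate,Top}.lean`)

WHY. g25's λ⁺-reading (`lambda_reading_plus_of_padicNorm`) reads the Iwasawa invariants of a plus branch function `Lη = L_p⁺(V,η,X)` off
the LOW MOMENTS `coeff_jθ_{2m}(η)`, `j ≤ λ`, but only for `λ < p − 1` (plus ONE corrected moment at the edge `λ = p − 1`,
`…PlusCoeffCongruenceTop`): in `θ_{2m}(η) = (−1)^{m+1}ω⁻_{2m}M⁺ + ω_{2m}q` the factor `ω⁻_{2m} = Φ_p(1+X)·Φ_{p³}(1+X)⋯` has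
`(ω⁻_{2m})_{p−1} ≡ p^{m−1}`, one `p` SHORT of the diagonal `(ω⁻_{2m})_0 = p^m`, so from degree `p − 1` on the moments of `θ` mix `M⁺_k` with
the LARGER term `(ω⁻)_{p−1}M⁺_{k−p+1}`; g25 left the rows with `λ⁺ ≥ p` (p = 5: 126 census rows, the in-table CM rank-one rows 78400gw1,
435600ui1 with `λ⁺ = 5`) to "a second elimination step". THIS FILE does all elimination steps at once by DIVIDING BY `ω⁻_{2m}`: the tree
proves `ω⁻_{2m} ∣ θ_{2m}(η)` in `ℚ[X]` (`cyclotomicOmegaMinus_dvd_quadraticBranchMazurTateElement`, the trivial zeros at the characters of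
odd-power conductor — this is how bsd-potss-ctrl BUILT `M⁺` as `lim (−1)^{m+1}θ_{2m}(η)/ω⁻_{2m}`), and with `ω_{2m} = X·ω⁺_{2m}·ω⁻_{2m}`
the integral congruence becomes, after cancelling `ω⁻_{2m}` in the domain `Λ`,
  `ℓ_m := θ_{2m}(η)/ω⁻_{2m} = (−1)^{m+1}M⁺ + X·ω⁺_{2m}·q`   (`q ∈ Λ`; §14),
and `p^m ∣ (ω⁺_{2m})_j` for EVERY `j < p(p−1)` (`ω⁺_{2m} = ∏_{i<m}Φ_{p^{2i+2}}(1+X)`, each factor Eisenstein of degree `≥ p(p−1)`; g24's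
`pow_dvd_coeff_cyclotomicOmegaPlus_two_mul_add_one`). Hence `coeff_kℓ_m ≡ (−1)^{m+1}coeff_kM⁺ (mod p^m)` for all `k ≤ p(p−1)` — NO diagonal
factor, NO triangular system, NO edge — and for every plus branch function `L = v·ϖ·M⁺` (`v ∈ ℤ_pˣ`):
  `‖coeff_kL − v(−1)^{m+1}ϖ·coeff_kℓ_m‖ ≤ p^{−m}`  (`k ≤ p(p−1)`):  THE QUOTIENT IS THE `p`-ADIC `L`-FUNCTION TO PRECISION `p^m`.
At `m ≥ 1`: `coeff_kL ∈ ℤ_pˣ ⟺ ‖ϖ·coeff_kℓ_m‖_p = 1`, per coefficient; so «`‖ϖ·ℓ_j‖ ≤ p⁻¹ (j < λ)`, `‖ϖ·ℓ_λ‖ = 1`» ⟺ «`μ(L) = 0 ∧ λ(L) = λ`»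
for every `λ ≤ p(p−1)` (`= 20, 42, 110` at `p = 5, 7, 11`; every `λ⁺` of the three CM censuses is `≤ 9`). The `λ + 1` rationals `coeff_jℓ_1` are
obtained from the SAME level-2 symbol vector `TH₂` as g25's moments by one exact division of `Σ_u TH₂[u](1+X)^u` by `Φ_p(1+X)` in `ℚ[X]`
(remainder `0` — itself a check of the symbol data).

WHAT. §14 `exists_quotient_map_eq_and_coe_eq` (an integral lift `Q ∈ ℤ_p[X]` of `ℓ_m` with `Q = (−1)^{m+1}M + X·ω⁺_{2m}·q` in `Λ`),
`pow_dvd_coeff_X_mul_cyclotomicOmegaPlus_mul` (`p^m ∣ (X·ω⁺_{2m}·q)_k`, `k ≤ p(p−1)`), `exists_coeff_quotient_plus_eq` (the coefficient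
congruence); §15 `exists_units_forall_norm_coeff_sub_quotient_le` (THE MASTER ESTIMATE for every `L`), `isUnit_coeff_plus_iff_norm_quotient_eq_one`
(per-coefficient unit reading, `m ≥ 1`), `lambda_reading_plus_of_quotient_padicNorm` / `quotient_padicNorm_of_firstUnitCoeff` /
`quotient_padicNorm_iff_firstUnitCoeff` (the reading, its converse, the equivalence), record-facing `hasUnitContent_and_mu_lam_plus_of_quotient_padicNorm`
(bridge = g25's `hasUnitContent_and_mu_lam_of_firstUnitCoeff`). Row currency (Mazur's `hM` for `‖ϖ‖ ≤ 1`) is the sequel `…QuotientMuCertificate.lean`.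

HONEST FRAMING (cell `bsd-potss`; FULL-BSD rank ≤ 1 programme, HUMAN RULING D-0036/D-0074): TOOL THEOREMS ONLY — no definition, no named fact,
no `sorry`, axioms standard; the quotient valuations stay DISPLAYED per-row hypotheses; nothing about (A), (C1⁺_η), C-cc-1 or `BSD(W,p)` of any
pair is claimed; `stub_analyticEtaMu_cm` (a class-wide `∀`) is NOT proved; crux and route OPEN; nothing booked. `--supports stmt-BirchSwinnertonDyer-19606`.

References: [Pollack2003] Prop. 6.18 and its proof (`L⁺ = lim θ_{2m}/ω⁻_{2m}`), §6.5; [Kobayashi2003] Thm. 3.2, (3.4), (3.6) (p. 7);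
[Washington1997] §7.1; [GreenbergVatsal2000] p. 2 (1)–(2). Tree: `Additive/QuadraticBranchPlusLFunctionExistence.lean`
(`cyclotomicOmegaMinus_dvd_quadraticBranchMazurTateElement`), `…MinusCoeffCongruence.lean` (`exists_sub_eq_omega_mul_of_isCongrModOmega`),
`…MinusCoeffCongruenceHigher.lean` (`pow_dvd_coeff_cyclotomicOmegaPlus_two_mul_add_one`), `…PlusCoeffCongruence{,Lambda,MuCertificate}.lean`.
-/

set_option autoImplicit false
set_option linter.dupNamespace false
noncomputable section

open scoped Classical MatrixGroups ModularForm

open CongruenceSubgroup Polynomial Literature.NumberTheory.EllipticCurves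
  Literature.NumberTheory.EllipticCurves.ModularForms
  Literature.NumberTheory.EllipticCurves.GreenbergVatsal2000
open Summit.BirchSwinnertonDyer.Rank1Residual Summit.BirchSwinnertonDyer.Rank1Residual.Additive
open Summit.BirchSwinnertonDyer.BirchSwinnertonDyer.Theorems.EtaMinusCoeffCongruence

namespace Summit.BirchSwinnertonDyer.BirchSwinnertonDyer.Theorems.EtaPlusCoeffCongruence

variable {p : ℕ} [hp : Fact p.Prime] {N : ℕ} [NeZero N] {f : CuspForm (Gamma0 N) 2}

/-! ## §14 The exact quotient `ℓ_m = θ_{2m}(η)/ω⁻_{2m}` is `(−1)^{m+1}M⁺` modulo `X·ω⁺_{2m}·Λ` -/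

omit [NeZero N] in
/-- The two routes `ℤ[X] → ℚ_p[X]` (through `ℚ` or through `ℤ_p`) agree. [folklore] -/
theorem map_map_intCast_eq_map_map_padicInt (ω : ℤ[X]) :
    (ω.map (Int.castRingHom ℚ)).map (algebraMap ℚ ℚ_[p]) =
      (ω.map (Int.castRingHom ℤ_[p])).map (algebraMap ℤ_[p] ℚ_[p]) := by
  rw [Polynomial.map_map, Polynomial.map_map,
    RingHom.ext_int ((algebraMap ℚ ℚ_[p]).comp (Int.castRingHom ℚ))
      ((algebraMap ℤ_[p] ℚ_[p]).comp (Int.castRingHom ℤ_[p]))]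

/-- **The exact quotient `θ_{2m}(η)/ω⁻_{2m}` IS the limit `(−1)^{m+1}M⁺` modulo `X·ω⁺_{2m}·Λ`.** `p` odd, `f` a rational newform of level
`N` prime to `p` with `a_p(f) = 0`, `M ∈ Λ` with `θ_{2m}(η) ≡ (−1)^{m+1}ω⁻_{2m}M (mod ω_{2m})`. Then the exact quotient
`ℓ_m = θ_{2m}(η) /ₘ ω⁻_{2m} ∈ ℚ[X]` (`ω⁻_{2m} ∣ θ_{2m}(η)`, `cyclotomicOmegaMinus_dvd_quadraticBranchMazurTateElement`) has an integral lift
`Q ∈ ℤ_p[X]` with `Q = (−1)^{m+1}M + X·ω⁺_{2m}·q` in `Λ` for some `q ∈ Λ`: write the integral congruence `Θ − (−1)^{m+1}ω⁻_{2m}M = ω_{2m}q`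
(`exists_sub_eq_omega_mul_of_isCongrModOmega`) as `ω⁻_{2m}·(Θ/ω⁻_{2m} − (−1)^{m+1}M − X·ω⁺_{2m}·q) = 0` using `ω_{2m} = X·ω⁺_{2m}·ω⁻_{2m}`
and cancel `ω⁻_{2m} ≠ 0` in the domain `Λ = ℤ_p⟦X⟧` (Pollack's construction of `L⁺` as `lim θ_{2m}/ω⁻_{2m}`).
[cite: Pollack2003, Prop. 6.18 (proof)] [cite: Kobayashi2003, Thm. 3.2 and (3.4) (p. 7)] -/
theorem exists_quotient_map_eq_and_coe_eq (hp2 : p ≠ 2) (hf0 : IsNewform0 f) (hQ : coeffField f = ⊥)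
    (hpN : ¬ p ∣ N) (hap : cuspCoeff f p = ((0 : ℤ) : ℂ)) (m : ℕ) {M : IwasawaAlgebra p}
    (hM : IsCongrModOmega p (2 * m) (quadraticBranchMazurTateElement p f (2 * m))
      ((-1) ^ (m + 1) * cyclotomicOmegaMinus p (2 * m)) M) :
    ∃ (Q : ℤ_[p][X]) (q : IwasawaAlgebra p),
      Q.map (algebraMap ℤ_[p] ℚ_[p]) =
        (quadraticBranchMazurTateElement p f (2 * m) /ₘ
          (cyclotomicOmegaMinus p (2 * m)).map (Int.castRingHom ℚ)).map (algebraMap ℚ ℚ_[p]) ∧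
      (Q : PowerSeries ℤ_[p]) = (-1) ^ (m + 1) * M +
        (((X * cyclotomicOmegaPlus p (2 * m)).map (Int.castRingHom ℤ_[p]) : ℤ_[p][X]) : PowerSeries ℤ_[p]) * q := by
  obtain ⟨Θ, q, hΘ, hid⟩ := exists_sub_eq_omega_mul_of_isCongrModOmega hp2 hf0 hQ hpN hap hM
  set θ := quadraticBranchMazurTateElement p f (2 * m) with hθdef
  set Ωm : ℤ_[p][X] := (cyclotomicOmegaMinus p (2 * m)).map (Int.castRingHom ℤ_[p]) with hΩm
  set ωQ : ℚ[X] := (cyclotomicOmegaMinus p (2 * m)).map (Int.castRingHom ℚ) with hωQ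
  have hmon : Ωm.Monic := (monic_cyclotomicOmegaMinus p (2 * m)).map _
  have hmonQ : ωQ.Monic := (monic_cyclotomicOmegaMinus p (2 * m)).map _
  have hdvdQ : ωQ ∣ θ := cyclotomicOmegaMinus_dvd_quadraticBranchMazurTateElement hf0 hQ hpN hap m
  have hΩmmap : Ωm.map (algebraMap ℤ_[p] ℚ_[p]) = ωQ.map (algebraMap ℚ ℚ_[p]) :=
    (map_map_intCast_eq_map_map_padicInt _).symm
  -- `Ωm ∣ Θ` in `ℤ_p[X]`: the remainder maps to `θ %ₘ ω⁻_{2m} = 0` in `ℚ_p[X]`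
  have hdvd : Ωm ∣ Θ := by
    rw [← modByMonic_eq_zero_iff_dvd hmon]
    apply Polynomial.map_injective (algebraMap ℤ_[p] ℚ_[p]) (IsFractionRing.injective ℤ_[p] ℚ_[p])
    rw [Polynomial.map_modByMonic _ hmon, Polynomial.map_zero, hΘ, hΩmmap, ← Polynomial.map_modByMonic _ hmonQ,
      (modByMonic_eq_zero_iff_dvd hmonQ).mpr hdvdQ, Polynomial.map_zero]
  refine ⟨Θ /ₘ Ωm, q, ?_, ?_⟩
  · rw [Polynomial.map_divByMonic _ hmon, hΘ, hΩmmap, ← Polynomial.map_divByMonic _ hmonQ]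
  · have hΘq : (Θ : PowerSeries ℤ_[p]) =
        (Ωm : PowerSeries ℤ_[p]) * ((Θ /ₘ Ωm : ℤ_[p][X]) : PowerSeries ℤ_[p]) := by
      rw [← Polynomial.coe_mul, mul_divByMonic_eq_of_monic_of_dvd hmon hdvd]
    have hω : ((((-1) ^ (m + 1) * cyclotomicOmegaMinus p (2 * m)).map (Int.castRingHom ℤ_[p]) : ℤ_[p][X]) :
        PowerSeries ℤ_[p]) = (-1) ^ (m + 1) * (Ωm : PowerSeries ℤ_[p]) := by
      rw [Polynomial.map_mul, Polynomial.map_pow, Polynomial.map_neg, Polynomial.map_one,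
        Polynomial.coe_mul, Polynomial.coe_pow, Polynomial.coe_neg, Polynomial.coe_one]
    have hΩ : (((cyclotomicOmega p (2 * m)).map (Int.castRingHom ℤ_[p]) : ℤ_[p][X]) : PowerSeries ℤ_[p]) =
        (((X * cyclotomicOmegaPlus p (2 * m)).map (Int.castRingHom ℤ_[p]) : ℤ_[p][X]) : PowerSeries ℤ_[p]) *
          (Ωm : PowerSeries ℤ_[p]) := by
      rw [← X_mul_cyclotomicOmegaPlus_mul_cyclotomicOmegaMinus, Polynomial.map_mul, Polynomial.coe_mul]
    rw [hΘq, hω, hΩ] at hid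
    have hne : (Ωm : PowerSeries ℤ_[p]) ≠ 0 := by
      rw [Ne, Polynomial.coe_eq_zero_iff]
      exact hmon.ne_zero
    have key : (Ωm : PowerSeries ℤ_[p]) * (((Θ /ₘ Ωm : ℤ_[p][X]) : PowerSeries ℤ_[p]) -
        ((-1) ^ (m + 1) * M +
          (((X * cyclotomicOmegaPlus p (2 * m)).map (Int.castRingHom ℤ_[p]) : ℤ_[p][X]) : PowerSeries ℤ_[p]) * q)) = 0 := by
      linear_combination hid
    exact sub_eq_zero.mp ((mul_eq_zero.mp key).resolve_left hne)

omit [NeZero N] in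
/-- **`p^m ∣ (X·ω⁺_{2m}·q)_k` for every `q ∈ Λ` and every `k ≤ p(p−1)`**: `(X·ω⁺_{2m})_0 = 0`, `(X·ω⁺_{2m})_{i+1} = (ω⁺_{2m})_i` and
`p^m ∣ (ω⁺_{2m})_i` for `i < p(p−1)` (`ω⁺_{2m} = ω⁺_{2m+1} = ∏_{i<m}Φ_{p^{2i+2}}(1+X)`, Eisenstein factors of degree `p^{2i+1}(p−1) ≥ p(p−1)`).
[cite: Pollack2003, §6.5 (display before Prop. 6.18)] [cite: Washington1997, §7.1] -/
theorem pow_dvd_coeff_X_mul_cyclotomicOmegaPlus_mul (m : ℕ) (q : IwasawaAlgebra p) {k : ℕ} (hk : k ≤ p * (p - 1)) :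
    (p : ℤ_[p]) ^ m ∣ PowerSeries.coeff k
      ((((X * cyclotomicOmegaPlus p (2 * m)).map (Int.castRingHom ℤ_[p]) : ℤ_[p][X]) : PowerSeries ℤ_[p]) * q) := by
  rw [PowerSeries.coeff_mul]
  refine Finset.dvd_sum fun x hx ↦ ?_
  have hsum : x.1 + x.2 = k := Finset.HasAntidiagonal.mem_antidiagonal.mp hx
  refine Dvd.dvd.mul_right ?_ _
  rw [Polynomial.coeff_coe, Polynomial.coeff_map]
  rcases Nat.eq_zero_or_pos x.1 with h0 | hpos
  · rw [h0, Polynomial.coeff_X_mul_zero, map_zero]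
    exact dvd_zero _
  · obtain ⟨i, hi⟩ : ∃ i, x.1 = i + 1 := ⟨x.1 - 1, by omega⟩
    rw [hi, Polynomial.coeff_X_mul, ← cyclotomicOmegaPlus_two_mul_add_one]
    have hdvd := pow_dvd_coeff_cyclotomicOmegaPlus_two_mul_add_one (p := p) m i (by omega)
    have h := map_dvd (Int.castRingHom ℤ_[p]) hdvd
    rwa [map_pow, map_natCast] at h

/-- **THE COEFFICIENT CONGRUENCE `coeff_kℓ_m ≡ (−1)^{m+1}coeff_kM⁺ (mod p^m)`, `k ≤ p(p−1)`** (`ℓ_m = θ_{2m}(η)/ω⁻_{2m}` the exact quotient in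
`ℚ[X]`, `M` the even-level limit at level `2m`): `coeff_kℓ_m = (−1)^{m+1}coeff_kM + p^m·r` for some `r ∈ ℤ_p`. No diagonal factor, no
triangular system: compare with the moment identity `coeff_kθ_{2m}(η) = (−1)^{m+1}Σ_{s+t=k}(ω⁻_{2m})_s coeff_tM + p^{2m}r` of
`…PlusCoeffCongruenceHigher` (`k < p` only). [cite: Pollack2003, Prop. 6.18 (proof)] [cite: Kobayashi2003, Thm. 3.2 and (3.4) (p. 7)] -/
theorem exists_coeff_quotient_plus_eq (hp2 : p ≠ 2) (hf0 : IsNewform0 f) (hQ : coeffField f = ⊥)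
    (hpN : ¬ p ∣ N) (hap : cuspCoeff f p = ((0 : ℤ) : ℂ)) (m : ℕ) {M : IwasawaAlgebra p}
    (hM : IsCongrModOmega p (2 * m) (quadraticBranchMazurTateElement p f (2 * m))
      ((-1) ^ (m + 1) * cyclotomicOmegaMinus p (2 * m)) M) {k : ℕ} (hk : k ≤ p * (p - 1)) :
    ∃ r : ℤ_[p], (((quadraticBranchMazurTateElement p f (2 * m) /ₘ
        (cyclotomicOmegaMinus p (2 * m)).map (Int.castRingHom ℚ)).coeff k : ℚ) : ℚ_[p]) =
      (-1) ^ (m + 1) * ((PowerSeries.coeff k M : ℤ_[p]) : ℚ_[p]) + (p : ℚ_[p]) ^ m * (r : ℚ_[p]) := by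
  obtain ⟨Q, q, hQmap, hQeq⟩ := exists_quotient_map_eq_and_coe_eq hp2 hf0 hQ hpN hap m hM
  obtain ⟨r, hr⟩ := pow_dvd_coeff_X_mul_cyclotomicOmegaPlus_mul m q hk
  refine ⟨r, ?_⟩
  have hε : ((-1 : PowerSeries ℤ_[p]) ^ (m + 1)) = PowerSeries.C ((-1 : ℤ_[p]) ^ (m + 1)) := by
    rw [map_pow, map_neg, map_one]
  have hk' := congrArg (PowerSeries.coeff k) hQeq
  rw [Polynomial.coeff_coe, map_add, hε, PowerSeries.coeff_C_mul, hr] at hk'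
  have hc := congrArg (fun P : ℚ_[p][X] ↦ P.coeff k) hQmap
  simp only [Polynomial.coeff_map, eq_ratCast] at hc
  rw [← hc, PadicInt.algebraMap_apply, hk']
  push_cast
  ring

/-! ## §15 The quotient reading for every plus branch function `L` -/

/-- **THE MASTER ESTIMATE: the quotient is the `p`-adic `L`-function to precision `p^m`.** `p` odd, `f` a rational newform of level `N` prime to `p`
with `a_p(f) = 0`, `‖ϖ‖_p ≤ 1`, `L` ANY function with `IsQuadraticBranchPlusLFunction f p ϖ L`. Then there is `v ∈ ℤ_pˣ` (the unit with
`L = v·ϖ·M⁺`, x1b's uniqueness) with `‖coeff_kL − v·(−1)^{m+1}·ϖ·coeff_kℓ_m‖_p ≤ p^{−m}` for every `m` and every `k ≤ p(p−1)`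
(`ℓ_m = θ_{2m}(η)/ω⁻_{2m}`). [cite: Pollack2003, Prop. 6.18] [cite: Kobayashi2003, Thm. 3.2, (3.4), (3.6) (p. 7)] -/
theorem exists_units_forall_norm_coeff_sub_quotient_le (hp2 : p ≠ 2) (hf0 : IsNewform0 f) (hQ : coeffField f = ⊥)
    (hpN : ¬ p ∣ N) (hap : cuspCoeff f p = ((0 : ℤ) : ℂ)) {ϖ : ℚ} (hϖ : ‖(ϖ : ℚ_[p])‖ ≤ 1)
    {L : IwasawaAlgebra p} (hL : IsQuadraticBranchPlusLFunction f p ϖ L) :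
    ∃ v : ℤ_[p]ˣ, ∀ (m k : ℕ), k ≤ p * (p - 1) →
      ‖((PowerSeries.coeff k L : ℤ_[p]) : ℚ_[p]) - ((v : ℤ_[p]) : ℚ_[p]) * (-1) ^ (m + 1) *
          ((ϖ : ℚ_[p]) * (((quadraticBranchMazurTateElement p f (2 * m) /ₘ
            (cyclotomicOmegaMinus p (2 * m)).map (Int.castRingHom ℚ)).coeff k : ℚ) : ℚ_[p]))‖ ≤ ((p : ℝ)⁻¹) ^ m := by
  have hP : p.Prime := hp.out
  have hp0 : (0 : ℝ) < p := by exact_mod_cast hP.pos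
  obtain ⟨M, hM⟩ := exists_isCongrModOmega_quadraticBranch_even hp2 hf0 hQ hpN hap
  obtain ⟨v, hv⟩ := exists_units_forall_coeff_eq_plus hp2 hϖ hL hM
  refine ⟨v, fun m k hk ↦ ?_⟩
  obtain ⟨r, hr⟩ := exists_coeff_quotient_plus_eq hp2 hf0 hQ hpN hap m (hM m) hk
  have hσ : ((-1 : ℚ_[p]) ^ (m + 1)) * (-1) ^ (m + 1) = 1 := by
    rw [← mul_pow, neg_one_mul, neg_neg, one_pow]
  have hdiff : ((PowerSeries.coeff k L : ℤ_[p]) : ℚ_[p]) - ((v : ℤ_[p]) : ℚ_[p]) * (-1) ^ (m + 1) *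
      ((ϖ : ℚ_[p]) * (((quadraticBranchMazurTateElement p f (2 * m) /ₘ
        (cyclotomicOmegaMinus p (2 * m)).map (Int.castRingHom ℚ)).coeff k : ℚ) : ℚ_[p])) =
      -(((v : ℤ_[p]) : ℚ_[p]) * (-1) ^ (m + 1) * ((p : ℚ_[p]) ^ m * ((ϖ : ℚ_[p]) * (r : ℚ_[p])))) := by
    rw [hv k, hr]
    linear_combination (-((v : ℤ_[p]) : ℚ_[p]) * ((ϖ : ℚ_[p]) * ((PowerSeries.coeff k M : ℤ_[p]) : ℚ_[p]))) * hσ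
  rw [hdiff, norm_neg, norm_mul, norm_mul, norm_mul, norm_pow, norm_neg, norm_one, one_pow, mul_one,
    PadicInt.padic_norm_e_of_padicInt, PadicInt.norm_units, one_mul, norm_pow, Padic.norm_p, norm_mul,
    PadicInt.padic_norm_e_of_padicInt]
  calc ((p : ℝ)⁻¹) ^ m * (‖(ϖ : ℚ_[p])‖ * ‖r‖) ≤ ((p : ℝ)⁻¹) ^ m * (1 * 1) := by
        gcongr
        exact PadicInt.norm_le_one r
    _ = ((p : ℝ)⁻¹) ^ m := by rw [mul_one, mul_one]

/-- **THE PER-COEFFICIENT UNIT READING.** With the data of `exists_units_forall_norm_coeff_sub_quotient_le`, `m ≥ 1` and `k ≤ p(p−1)`: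
`coeff_kL ∈ ℤ_pˣ ⟺ ‖ϖ·coeff_kℓ_m‖_p = 1` (`ℓ_m = θ_{2m}(η)/ω⁻_{2m}`; both sides have norm `≤ 1` and differ, up to the unit `±v`, by a term of
norm `≤ p^{−m} < 1`). [cite: Pollack2003, Prop. 6.18] [cite: Washington1997, §7.1] -/
theorem isUnit_coeff_plus_iff_norm_quotient_eq_one (hp2 : p ≠ 2) (hf0 : IsNewform0 f) (hQ : coeffField f = ⊥)
    (hpN : ¬ p ∣ N) (hap : cuspCoeff f p = ((0 : ℤ) : ℂ)) {ϖ : ℚ} (hϖ : ‖(ϖ : ℚ_[p])‖ ≤ 1)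
    {L : IwasawaAlgebra p} (hL : IsQuadraticBranchPlusLFunction f p ϖ L) (m : ℕ) (hm : 1 ≤ m) {k : ℕ}
    (hk : k ≤ p * (p - 1)) :
    IsUnit (PowerSeries.coeff k L) ↔
      ‖(ϖ : ℚ_[p]) * (((quadraticBranchMazurTateElement p f (2 * m) /ₘ
        (cyclotomicOmegaMinus p (2 * m)).map (Int.castRingHom ℚ)).coeff k : ℚ) : ℚ_[p])‖ = 1 := by
  have hP : p.Prime := hp.out
  have hp1 : (1 : ℝ) < p := by exact_mod_cast hP.one_lt
  have hp0 : (0 : ℝ) < p := by positivity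
  obtain ⟨v, hv⟩ := exists_units_forall_norm_coeff_sub_quotient_le hp2 hf0 hQ hpN hap hϖ hL
  have hest := hv m k hk
  set a : ℚ_[p] := ((PowerSeries.coeff k L : ℤ_[p]) : ℚ_[p]) with ha
  set c : ℚ_[p] := (ϖ : ℚ_[p]) * (((quadraticBranchMazurTateElement p f (2 * m) /ₘ
    (cyclotomicOmegaMinus p (2 * m)).map (Int.castRingHom ℚ)).coeff k : ℚ) : ℚ_[p]) with hc
  set b : ℚ_[p] := ((v : ℤ_[p]) : ℚ_[p]) * (-1) ^ (m + 1) * c with hb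
  have hnb : ‖b‖ = ‖c‖ := by
    rw [hb, norm_mul, norm_mul, PadicInt.padic_norm_e_of_padicInt, PadicInt.norm_units, one_mul, norm_pow, norm_neg,
      norm_one, one_pow, one_mul]
  have hlt1 : ‖a - b‖ < 1 :=
    hest.trans_lt (pow_lt_one₀ (inv_nonneg.mpr hp0.le) (inv_lt_one_of_one_lt₀ hp1) (by omega))
  have hna : ‖a‖ = ‖PowerSeries.coeff k L‖ := by rw [ha, PadicInt.padic_norm_e_of_padicInt]
  rw [PadicInt.isUnit_iff, ← hna, ← hnb]
  constructor
  · intro h1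
    -- `b = a − (a − b)` with `‖a − b‖ < 1 = ‖a‖`
    have hne : ‖a‖ ≠ ‖-(a - b)‖ := by rw [norm_neg, h1]; exact (ne_of_lt hlt1).symm
    have e : b = a + -(a - b) := by ring
    rw [e, Padic.add_eq_max_of_ne hne, norm_neg, max_eq_left (h1 ▸ hlt1.le), h1]
  · intro h1
    have hne : ‖a - b‖ ≠ ‖b‖ := by rw [h1]; exact ne_of_lt hlt1
    have e : a = (a - b) + b := by ring
    rw [e, Padic.add_eq_max_of_ne hne, h1, max_eq_right hlt1.le]

/-- The complementary reading: `coeff_kL ∉ ℤ_pˣ ⟺ ‖ϖ·coeff_kℓ_m‖_p ≤ p⁻¹` (`m ≥ 1`, `k ≤ p(p−1)`; the quotient coefficient is `p`-integral, so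
"not a unit" is "norm below `1`" is "norm `≤ p⁻¹`"). [cite: Pollack2003, Prop. 6.18] [cite: Washington1997, §7.1] -/
theorem not_isUnit_coeff_plus_iff_norm_quotient_le (hp2 : p ≠ 2) (hf0 : IsNewform0 f) (hQ : coeffField f = ⊥)
    (hpN : ¬ p ∣ N) (hap : cuspCoeff f p = ((0 : ℤ) : ℂ)) {ϖ : ℚ} (hϖ : ‖(ϖ : ℚ_[p])‖ ≤ 1)
    {L : IwasawaAlgebra p} (hL : IsQuadraticBranchPlusLFunction f p ϖ L) (m : ℕ) (hm : 1 ≤ m) {k : ℕ}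
    (hk : k ≤ p * (p - 1)) :
    ¬ IsUnit (PowerSeries.coeff k L) ↔
      ‖(ϖ : ℚ_[p]) * (((quadraticBranchMazurTateElement p f (2 * m) /ₘ
        (cyclotomicOmegaMinus p (2 * m)).map (Int.castRingHom ℚ)).coeff k : ℚ) : ℚ_[p])‖ ≤ (p : ℝ)⁻¹ := by
  have hP : p.Prime := hp.out
  have hp1 : (1 : ℝ) < p := by exact_mod_cast hP.one_lt
  have hp0 : (0 : ℝ) < p := by positivity
  rw [isUnit_coeff_plus_iff_norm_quotient_eq_one hp2 hf0 hQ hpN hap hϖ hL m hm hk]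
  -- the quotient coefficient is `p`-integral: its norm is `≤ 1`
  obtain ⟨M, hM⟩ := exists_isCongrModOmega_quadraticBranch_even hp2 hf0 hQ hpN hap
  obtain ⟨Q, q, hQmap, -⟩ := exists_quotient_map_eq_and_coe_eq hp2 hf0 hQ hpN hap m (hM m)
  have hc := congrArg (fun P : ℚ_[p][X] ↦ P.coeff k) hQmap
  simp only [Polynomial.coeff_map, eq_ratCast] at hc
  set c : ℚ_[p] := (ϖ : ℚ_[p]) * (((quadraticBranchMazurTateElement p f (2 * m) /ₘ
    (cyclotomicOmegaMinus p (2 * m)).map (Int.castRingHom ℚ)).coeff k : ℚ) : ℚ_[p]) with hcdef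
  have hle : ‖c‖ ≤ 1 := by
    rw [hcdef, ← hc, PadicInt.algebraMap_apply, norm_mul, PadicInt.padic_norm_e_of_padicInt]
    calc ‖(ϖ : ℚ_[p])‖ * ‖Q.coeff k‖ ≤ 1 * 1 := by gcongr; exact PadicInt.norm_le_one _
      _ = 1 := mul_one 1
  constructor
  · intro hne
    have hlt : ‖c‖ < 1 := lt_of_le_of_ne hle hne
    have h := (Padic.norm_le_pow_iff_norm_lt_pow_add_one c (-1)).mpr
      (by rwa [show (-1 : ℤ) + 1 = 0 by norm_num, zpow_zero])
    rwa [zpow_neg, zpow_one] at h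
  · intro h h1
    rw [h1] at h
    exact absurd h (not_le.mpr (inv_lt_one_of_one_lt₀ hp1))

/-- **THE QUOTIENT READING of `μ⁺ = 0` and `λ⁺ = λ`, every `λ ≤ p(p−1)`.** `p` odd, `f` a rational newform of level `N` prime to `p` with `a_p(f) = 0`,
`‖ϖ‖_p ≤ 1`, `L` ANY function with `IsQuadraticBranchPlusLFunction f p ϖ L`, `m ≥ 1`, `λ ≤ p(p−1)`. DISPLAYED (finite symbol data: the
coefficients of the exact quotient `ℓ_m = θ_{2m}(η)/ω⁻_{2m} ∈ ℚ[X]`): `‖ϖ·coeff_jℓ_m‖_p ≤ p⁻¹` for `j < λ` and `‖ϖ·coeff_λℓ_m‖_p = 1`. CONCLUSION: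
`coeff_jL ∉ ℤ_pˣ` for `j < λ` and `coeff_λL ∈ ℤ_pˣ` — `μ(L) = 0`, `λ(L) = λ`. [cite: Pollack2003, Prop. 6.18] [cite: Kobayashi2003, Thm. 3.2, (3.4), (3.6) (p. 7)]
[cite: Washington1997, §7.1] -/
theorem lambda_reading_plus_of_quotient_padicNorm (hp2 : p ≠ 2) (hf0 : IsNewform0 f) (hQ : coeffField f = ⊥)
    (hpN : ¬ p ∣ N) (hap : cuspCoeff f p = ((0 : ℤ) : ℂ)) {ϖ : ℚ} (hϖ : ‖(ϖ : ℚ_[p])‖ ≤ 1)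
    {L : IwasawaAlgebra p} (hL : IsQuadraticBranchPlusLFunction f p ϖ L) (m : ℕ) (hm : 1 ≤ m) {lam : ℕ}
    (hlam : lam ≤ p * (p - 1))
    (hlow : ∀ j < lam, ‖(ϖ : ℚ_[p]) * (((quadraticBranchMazurTateElement p f (2 * m) /ₘ
        (cyclotomicOmegaMinus p (2 * m)).map (Int.castRingHom ℚ)).coeff j : ℚ) : ℚ_[p])‖ ≤ (p : ℝ)⁻¹)
    (htop : ‖(ϖ : ℚ_[p]) * (((quadraticBranchMazurTateElement p f (2 * m) /ₘ
        (cyclotomicOmegaMinus p (2 * m)).map (Int.castRingHom ℚ)).coeff lam : ℚ) : ℚ_[p])‖ = 1) :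
    (∀ j < lam, ¬ IsUnit (PowerSeries.coeff j L)) ∧ IsUnit (PowerSeries.coeff lam L) :=
  ⟨fun j hj ↦ (not_isUnit_coeff_plus_iff_norm_quotient_le hp2 hf0 hQ hpN hap hϖ hL m hm (by omega)).mpr (hlow j hj),
    (isUnit_coeff_plus_iff_norm_quotient_eq_one hp2 hf0 hQ hpN hap hϖ hL m hm hlam).mpr htop⟩

/-- **CONVERSE of the quotient reading.** If `coeff_jL ∉ ℤ_pˣ` for `j < λ` and `coeff_λL ∈ ℤ_pˣ` (`μ(L) = 0`, `λ(L) = λ`), `m ≥ 1`, `λ ≤ p(p−1)`,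
then the quotient SHOWS it: `‖ϖ·coeff_jℓ_m‖_p ≤ p⁻¹` (`j < λ`) and `‖ϖ·coeff_λℓ_m‖_p = 1` — at EVERY level `2m ≥ 2`.
[cite: Pollack2003, Prop. 6.18] [cite: Washington1997, §7.1] -/
theorem quotient_padicNorm_of_firstUnitCoeff (hp2 : p ≠ 2) (hf0 : IsNewform0 f) (hQ : coeffField f = ⊥)
    (hpN : ¬ p ∣ N) (hap : cuspCoeff f p = ((0 : ℤ) : ℂ)) {ϖ : ℚ} (hϖ : ‖(ϖ : ℚ_[p])‖ ≤ 1)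
    {L : IwasawaAlgebra p} (hL : IsQuadraticBranchPlusLFunction f p ϖ L) (m : ℕ) (hm : 1 ≤ m) {lam : ℕ}
    (hlam : lam ≤ p * (p - 1)) (hunit : (∀ j < lam, ¬ IsUnit (PowerSeries.coeff j L)) ∧ IsUnit (PowerSeries.coeff lam L)) :
    (∀ j < lam, ‖(ϖ : ℚ_[p]) * (((quadraticBranchMazurTateElement p f (2 * m) /ₘ
        (cyclotomicOmegaMinus p (2 * m)).map (Int.castRingHom ℚ)).coeff j : ℚ) : ℚ_[p])‖ ≤ (p : ℝ)⁻¹) ∧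
    ‖(ϖ : ℚ_[p]) * (((quadraticBranchMazurTateElement p f (2 * m) /ₘ
        (cyclotomicOmegaMinus p (2 * m)).map (Int.castRingHom ℚ)).coeff lam : ℚ) : ℚ_[p])‖ = 1 :=
  ⟨fun j hj ↦ (not_isUnit_coeff_plus_iff_norm_quotient_le hp2 hf0 hQ hpN hap hϖ hL m hm (by omega)).mp (hunit.1 j hj),
    (isUnit_coeff_plus_iff_norm_quotient_eq_one hp2 hf0 hQ hpN hap hϖ hL m hm hlam).mp hunit.2⟩

/-- **THE EQUIVALENCE.** For a plus branch function `L` (`‖ϖ‖_p ≤ 1`), `m ≥ 1`, `λ ≤ p(p−1)`: the displayed quotient pattern at level `2m` holds iff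
`coeff_jL ∉ ℤ_pˣ` (`j < λ`) and `coeff_λL ∈ ℤ_pˣ` — iff `μ(L) = 0 ∧ λ(L) = λ`; in particular the pattern at one level `2m ≥ 2` implies it at
every other. A row whose quotient violates its pattern REFUTES the claim «`μ⁺ = 0`, `λ⁺ = λ`» for that row. [cite: Pollack2003, Prop. 6.18]
[cite: Washington1997, §7.1] -/
theorem quotient_padicNorm_iff_firstUnitCoeff (hp2 : p ≠ 2) (hf0 : IsNewform0 f) (hQ : coeffField f = ⊥)
    (hpN : ¬ p ∣ N) (hap : cuspCoeff f p = ((0 : ℤ) : ℂ)) {ϖ : ℚ} (hϖ : ‖(ϖ : ℚ_[p])‖ ≤ 1)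
    {L : IwasawaAlgebra p} (hL : IsQuadraticBranchPlusLFunction f p ϖ L) (m : ℕ) (hm : 1 ≤ m) {lam : ℕ}
    (hlam : lam ≤ p * (p - 1)) :
    ((∀ j < lam, ‖(ϖ : ℚ_[p]) * (((quadraticBranchMazurTateElement p f (2 * m) /ₘ
        (cyclotomicOmegaMinus p (2 * m)).map (Int.castRingHom ℚ)).coeff j : ℚ) : ℚ_[p])‖ ≤ (p : ℝ)⁻¹) ∧
      ‖(ϖ : ℚ_[p]) * (((quadraticBranchMazurTateElement p f (2 * m) /ₘ
        (cyclotomicOmegaMinus p (2 * m)).map (Int.castRingHom ℚ)).coeff lam : ℚ) : ℚ_[p])‖ = 1) ↔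
    ((∀ j < lam, ¬ IsUnit (PowerSeries.coeff j L)) ∧ IsUnit (PowerSeries.coeff lam L)) :=
  ⟨fun h ↦ lambda_reading_plus_of_quotient_padicNorm hp2 hf0 hQ hpN hap hϖ hL m hm hlam h.1 h.2,
    fun h ↦ quotient_padicNorm_of_firstUnitCoeff hp2 hf0 hQ hpN hap hϖ hL m hm hlam h⟩

/-- **THE μ⁺-CERTIFICATE IN QUOTIENT CURRENCY (record-facing).** For every plus branch function `L` of a rational `a_p = 0` newform `f` (level prime
to the odd prime `p`, `‖ϖ‖_p ≤ 1`): `m ≥ 1`, `λ ≤ p(p−1)` and the DISPLAYED valuations «`‖ϖ·coeff_jℓ_m‖ ≤ p⁻¹` (`j < λ`), `‖ϖ·coeff_λℓ_m‖ = 1`»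
(`ℓ_m = θ_{2m}(η)/ω⁻_{2m}`) give `HasUnitContent L` — verbatim the conclusion of v7's `stub_analyticEtaMu_cm` for this `L` — together with
`μ(L) = 0`, `λ(L) = λ`, `normLam L = λ`. [cite: Pollack2003, Prop. 6.18] [cite: Kobayashi2003, Thm. 3.2, (3.4), (3.6) (p. 7)]
[cite: GreenbergVatsal2000, p. 2, (1)–(2)] -/
theorem hasUnitContent_and_mu_lam_plus_of_quotient_padicNorm (hp2 : p ≠ 2) (hf0 : IsNewform0 f) (hQ : coeffField f = ⊥)
    (hpN : ¬ p ∣ N) (hap : cuspCoeff f p = ((0 : ℤ) : ℂ)) {ϖ : ℚ} (hϖ : ‖(ϖ : ℚ_[p])‖ ≤ 1)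
    {L : IwasawaAlgebra p} (hL : IsQuadraticBranchPlusLFunction f p ϖ L) (m : ℕ) (hm : 1 ≤ m) {lam : ℕ}
    (hlam : lam ≤ p * (p - 1))
    (hlow : ∀ j < lam, ‖(ϖ : ℚ_[p]) * (((quadraticBranchMazurTateElement p f (2 * m) /ₘ
        (cyclotomicOmegaMinus p (2 * m)).map (Int.castRingHom ℚ)).coeff j : ℚ) : ℚ_[p])‖ ≤ (p : ℝ)⁻¹)
    (htop : ‖(ϖ : ℚ_[p]) * (((quadraticBranchMazurTateElement p f (2 * m) /ₘ
        (cyclotomicOmegaMinus p (2 * m)).map (Int.castRingHom ℚ)).coeff lam : ℚ) : ℚ_[p])‖ = 1) :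
    HasUnitContent L ∧ X1.MuLambda.mu L = 0 ∧ X1.MuLambda.lam L = lam ∧ normLam L = lam :=
  hasUnitContent_and_mu_lam_of_firstUnitCoeff
    (lambda_reading_plus_of_quotient_padicNorm hp2 hf0 hQ hpN hap hϖ hL m hm hlam hlow htop)

end Summit.BirchSwinnertonDyer.BirchSwinnertonDyer.Theorems.EtaPlusCoeffCongruence

end
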